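import Mathlib
import HarnessLib
import Summits.QuantumFields.YangMills.Theses.FlowLineStateSpace

/-!
# `CurvatureNonGaussianity` (stmt-QuantumFields-9118) — the crux-strategist's TYPED DECOMPOSITION (trace-anomaly dichotomy)

Support file for the crux `Summit.QuantumFields.YangMills.Theses.FlowLineStateSpace.CurvatureNonGaussianity` of route
`FlowLineStateSpace` (unit `cstrat-stmt-QuantumFields-9118-r1`, BC2-redirect re-audit 2026-08-17). The crux says: along every
`(G, r, sch)` with (VS) exact vacuum subtraction, (UVB) uniform off-diagonal bounds, (ND) a two-point lower bound and (CL)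
clustering, SOME off-diagonal three-point functional `LS k 3 (f⊗g⊗h)` of the renormalised curvature field stays `≥ δ`
frequently in `k`. It is decomposed into three pieces, each a `def … : Prop` whose body is VERBATIM the child statement filed
with `ledger route edit --split CurvatureNonGaussianity` (obligation pieces of OUR crux, deliberately untagged):

* `AnomalyInsertionLocality` (A) — with `D_k(F) := c_k a_k⁴ · ∂_b LS_b(k,2,F)|_(b=β_k)` the ANOMALY INSERTION (the coupling
  derivative of the two-point functional at frozen renormalisation; by the exact Gibbs identity the full torus sum of the third
  curvature insertion): along an asymptotically free, uniformly clustering scheme, `D_k(F)` differs from a UNIVERSAL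
  multiplicative renormalisation `d(ρ)_k · LS(k,2,F)` only by finitely many OFF-DIAGONAL pure-tensor three-point functionals,
  up to `ε` (the OPE / contact structure of the integrated insertion — the one ultraviolet input);
* `CouplingDerivativeTransmutation` (B) — along an asymptotically free scheme `D_k` is NOT asymptotically a pure renormalisation:
  for two compactly supported off-diagonal pure two-tensors and some `δ > 0`, for EVERY scalar sequence `d_k`, frequently
  `δ ≤ Σᵢ ‖D_k Fᵢ − d_k LS(k,2,Fᵢ)‖` (dimensional transmutation: the coupling derivative is a dilation, and a clustering
  non-zero two-point function is not homogeneous) — a pure TWO-point statement;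
* `NonGaussianityOffScaling` (C) — the crux outside the regime of A/B (schemes that are not asymptotically free or not
  uniformly clustering in the third insertion): a scope piece of the crux's universal quantifier (the deciding theorem feeds
  the crux only `MassiveScalingSequence`'s asymptotically free scheme).

`curvatureNonGaussianity_of_subs : A → B → C → CurvatureNonGaussianity` is sorry-free: fix `G, r, sch` and the four
hypotheses; by cases on the regime; in the good regime by contradiction through the abstract `anomaly_dichotomy` — if every
off-diagonal three-point functional died, A would make `D_k(Fᵢ)` eventually `δ/2`-close to `d(ρ)_k LS(k,2,Fᵢ)` for both
tensors with ONE scalar sequence, which B forbids. The join is short on purpose (`trivial_seam` in the BC2 sense); the content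
sits in the typed pieces, none of which gives the crux or the Statement alone (probes in the strategist's folder `bc/`).
References: Lüscher, JHEP 08 (2010) 071 (arXiv:1006.4518); Lüscher–Weisz, JHEP 02 (2011) 051 (arXiv:1101.0963); Suzuki,
PTEP 2013 083B03 (arXiv:1304.0533); Osterwalder–Schrader, CMP 42 (1975); Osterwalder–Seiler, Ann. Phys. 110 (1978).
-/

open Filter

namespace Summit.QuantumFields.YangMills.Theorems.CurvatureNonGaussianitySplit

/-! ## §1 The abstract dichotomy (pure filter / inequality logic over opaque functionals) -/

/-- **Anomaly dichotomy, abstract form.** For opaque two-point `W`, three-point `T` and insertion `D` functionals: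
if `D` is, up to `ε`, a universal multiple of `W` plus finitely many admissible three-point functionals (A-shape), and
`D` is frequently `δ`-far from every multiple of `W` jointly on two tensors (B-shape), then some admissible three-point
functional is frequently `≥ δ' > 0` (by contradiction: vanishing functionals + A give eventual `δ/2`-proportionality with
one scalar sequence, contradicting B via `Frequently.and_eventually`). [folklore] -/
theorem anomaly_dichotomy {σ ι₂ ι₃ : Type*}
    {Tens₂ : ι₂ → σ → σ → Prop} {Off₂ : ι₂ → Prop} {Cpt : σ → Prop}
    {Tens₃ : ι₃ → σ → σ → σ → Prop} {Off₃ : ι₃ → Prop}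
    {W : ℕ → ι₂ → ℂ} {T : ℕ → ι₃ → ℂ} {D : ℕ → ι₂ → ℂ}
    (hA : ∃ d : ℝ → ℕ → ℂ, ∀ (f g : σ) (F : ι₂), Tens₂ F f g → Off₂ F → Cpt f → Cpt g →
      ∀ ε : ℝ, 0 < ε → ∃ ρ₀ : ℝ, 0 < ρ₀ ∧ ∀ ρ : ℝ, 0 < ρ → ρ < ρ₀ →
        ∃ (N : ℕ) (H' : Fin N → ι₃), (∀ j, ∃ (f' g' h' : σ), Tens₃ (H' j) f' g' h' ∧ Off₃ (H' j)) ∧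
          ∀ᶠ k in atTop, ‖D k F - ∑ j, T k (H' j) - d ρ k * W k F‖ ≤ ε)
    (hB : ∃ (f₁ g₁ f₂ g₂ : σ) (F₁ F₂ : ι₂), Tens₂ F₁ f₁ g₁ ∧ Tens₂ F₂ f₂ g₂ ∧ Off₂ F₁ ∧ Off₂ F₂ ∧
      Cpt f₁ ∧ Cpt g₁ ∧ Cpt f₂ ∧ Cpt g₂ ∧ ∃ δ : ℝ, 0 < δ ∧ ∀ d : ℕ → ℂ,
        ∃ᶠ k in atTop, δ ≤ ‖D k F₁ - d k * W k F₁‖ + ‖D k F₂ - d k * W k F₂‖) :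
    ∃ (f g h : σ) (F₃ : ι₃), Tens₃ F₃ f g h ∧ Off₃ F₃ ∧ ∃ δ : ℝ, 0 < δ ∧
      ∃ᶠ k in atTop, δ ≤ ‖T k F₃‖ := by
  by_contra hNG
  -- negation: every off-diagonal pure three-tensor has an asymptotically vanishing functional
  have hvan : ∀ (H : ι₃), (∃ (f' g' h' : σ), Tens₃ H f' g' h' ∧ Off₃ H) →
      ∀ δ : ℝ, 0 < δ → ∀ᶠ k in atTop, ‖T k H‖ < δ := by
    intro H ⟨f', g', h', hT, hO⟩ δ hδ
    by_contra hne
    apply hNG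
    refine ⟨f', g', h', H, hT, hO, δ, hδ, ?_⟩
    rw [Filter.not_eventually] at hne
    exact hne.mono fun k hk => not_lt.mp hk
  obtain ⟨d, hd⟩ := hA
  obtain ⟨f₁, g₁, f₂, g₂, F₁, F₂, hT₁, hT₂, hO₁, hO₂, hf₁, hg₁, hf₂, hg₂, δ, hδ, hBd⟩ := hB
  -- finite off-diagonal families have eventually small total functional
  have hfam : ∀ (N : ℕ) (H' : Fin N → ι₃), (∀ j, ∃ (f' g' h' : σ), Tens₃ (H' j) f' g' h' ∧ Off₃ (H' j)) →
      ∀ η : ℝ, 0 < η → ∀ᶠ k in atTop, ‖∑ j, T k (H' j)‖ ≤ η := by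
    intro N H' hH' η hη
    have hη' : 0 < η / (N + 1) := by positivity
    have hall : ∀ᶠ k in atTop, ∀ j, ‖T k (H' j)‖ < η / (N + 1) :=
      Filter.eventually_all.2 fun j => hvan (H' j) (hH' j) _ hη'
    refine hall.mono fun k hk => ?_
    calc ‖∑ j, T k (H' j)‖ ≤ ∑ j, ‖T k (H' j)‖ := norm_sum_le _ _
      _ ≤ ∑ _j : Fin N, η / (N + 1) := Finset.sum_le_sum fun j _ => (hk j).le
      _ = N * (η / (N + 1)) := by simp
      _ ≤ η := by
          rw [mul_div_assoc']
          rw [div_le_iff₀ (by positivity)]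
          nlinarith
  -- apply piece A to both tensors with ε = δ/4
  have hδ4 : 0 < δ / 4 := by positivity
  obtain ⟨ρ₁, hρ₁, h₁⟩ := hd f₁ g₁ F₁ hT₁ hO₁ hf₁ hg₁ (δ / 4) hδ4
  obtain ⟨ρ₂, hρ₂, h₂⟩ := hd f₂ g₂ F₂ hT₂ hO₂ hf₂ hg₂ (δ / 4) hδ4
  set ρ : ℝ := min ρ₁ ρ₂ / 2 with hρdef
  have hρpos : 0 < ρ := by positivity
  have hρlt₁ : ρ < ρ₁ := by
    have := min_le_left ρ₁ ρ₂
    rw [hρdef]; linarith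
  have hρlt₂ : ρ < ρ₂ := by
    have := min_le_right ρ₁ ρ₂
    rw [hρdef]; linarith
  obtain ⟨N₁, H₁, hH₁, hev₁⟩ := h₁ ρ hρpos hρlt₁
  obtain ⟨N₂, H₂, hH₂, hev₂⟩ := h₂ ρ hρpos hρlt₂
  have hδ8 : 0 < δ / 8 := by positivity
  have hs₁ := hfam N₁ H₁ hH₁ (δ / 8) hδ8
  have hs₂ := hfam N₂ H₂ hH₂ (δ / 8) hδ8
  -- eventually the deviation from proportionality is < δ
  have hsmall : ∀ᶠ k in atTop,
      ‖D k F₁ - d ρ k * W k F₁‖ + ‖D k F₂ - d ρ k * W k F₂‖ < δ := by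
    filter_upwards [hev₁, hev₂, hs₁, hs₂] with k hk₁ hk₂ hk₃ hk₄
    have e₁ : D k F₁ - d ρ k * W k F₁ =
        (D k F₁ - ∑ j, T k (H₁ j) - d ρ k * W k F₁) + ∑ j, T k (H₁ j) := by ring
    have e₂ : D k F₂ - d ρ k * W k F₂ =
        (D k F₂ - ∑ j, T k (H₂ j) - d ρ k * W k F₂) + ∑ j, T k (H₂ j) := by ring
    have b₁ : ‖D k F₁ - d ρ k * W k F₁‖ ≤ δ / 4 + δ / 8 := by
      rw [e₁]; exact (norm_add_le _ _).trans (add_le_add hk₁ hk₃)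
    have b₂ : ‖D k F₂ - d ρ k * W k F₂‖ ≤ δ / 4 + δ / 8 := by
      rw [e₂]; exact (norm_add_le _ _).trans (add_le_add hk₂ hk₄)
    linarith
  -- while piece B says it is frequently ≥ δ
  obtain ⟨k, hk, hk'⟩ := (hsmall.and_frequently (hBd (d ρ))).exists
  exact absurd hk' (not_le.mpr hk)

/-! ## §2 The three pieces (VERBATIM the children statements; obligation pieces, deliberately untagged) -/

/-- **Piece A · `AnomalyInsertionLocality`** — contact structure of the anomaly insertion (OPEN; OPE core). For every compact
simple `G`, `r`, `sch` with (VS), (UVB), (ND), (CL), asymptotic freedom `β_k → ∞` and uniform `ℓ¹`-clustering of the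
three-point functional in the far third variable (UC): there is a universal `d : ℝ → ℕ → ℂ` such that for all compactly
supported `f, g` with `f⊗g` off-diagonal and all `ε > 0`, for all small `ρ`, finitely many OFF-DIAGONAL pure three-tensors
`H'ⱼ` satisfy eventually `‖D_k(f⊗g) − Σⱼ LS(k,3,H'ⱼ) − d ρ k · LS(k,2,f⊗g)‖ ≤ ε`. -/
def AnomalyInsertionLocality : Prop :=
  open Literature.MathematicalPhysics.QuantumFieldTheory Literature.MathematicalPhysics.QuantumLattice Literature.MathematicalPhysics.AQFT Literature.Probability.LatticeModels in ∀ (G : Type) [Group G] [TopologicalSpace G] [IsTopologicalGroup G] [CompactSpace G], IsCompactSimpleLieGroup G → letI : MeasurableSpace G := borel G; haveI : BorelSpace G := ⟨rfl⟩; ∀ (r : LatticeRep G) (sch : SpeciesScheme (YMSpecies G)), let μ := fun k : ℕ => wilsonMeasure (d := 4) (L := sch.side k) r.ρ (sch.β k); let LS := fun (k n : ℕ) (F : SchwartzMap (Fin n → EuclideanSpace ℝ (Fin 4)) ℂ) => (∫ U, ∑ x : Fin n → ↥(box 4 (sch.L k)), F (fun i => sch.a k • siteToE ↑(x i)) * ∏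 i, ((sch.c r.curvature k * sch.a k ^ 4 * (r.curvature.F (configShift (-↑(x i)) (torusLift (sch.side k) U)) - sch.m r.curvature k) : ℝ) : ℂ) ∂μ k); let LSb := fun (k n : ℕ) (F : SchwartzMap (Fin n → EuclideanSpace ℝ (Fin 4)) ℂ) (b : ℝ) => (∫ U, ∑ x : Fin n → ↥(box 4 (sch.L k)), F (fun i => sch.a k • siteToE ↑(x i)) * ∏ i, ((sch.c r.curvature k * sch.a k ^ 4 * (r.curvature.F (configShift (-↑(x i)) (torusLift (sch.side k) U)) - sch.m r.curvature k) : ℝ) : ℂ) ∂(wilsonMeasure (d := 4) (L := sch.side k) r.ρ b)); let D := fun (k : ℕ) (F : SchwartzMap (Fin 2 → EuclideanSpace ℝ (Fin 4)) ℂ) => ((sch.c r.curvature k * sch.a k ^ 4 : ℝ) : ℂ) * deriv (fun b : ℝ => LSb k 2 F b) (sch.β k); (∀ k : ℕ, sch.m r.curvature k = ∫ U, r.curvature.F (torusLift (sch.side k) U) ∂μ k) → (∃ (s : ℕ) (α β : ℝ), ∀ (n : ℕ) (F : SchwartzMap (Fin n → EuclideanSpace ℝ (Fin 4)) ℂ),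 IsOffDiagonal F → ∀ᶠ k in Filter.atTop, ‖LS k n F‖ ≤ α * (n.factorial : ℝ) ^ β * schwartzNorm (n * s) F) → (∃ (f g : SchwartzMap (Fin 1 → EuclideanSpace ℝ (Fin 4)) ℂ) (H : SchwartzMap (Fin (1 + 1) → EuclideanSpace ℝ (Fin 4)) ℂ), IsTimeOrdered f ∧ IsTimeOrdered g ∧ IsAppendTensorOf H (osAdjoint f) g ∧ ∃ δ : ℝ, 0 < δ ∧ ∀ᶠ k in Filter.atTop, δ ≤ ‖LS k (1 + 1) H‖) → (∃ Δ : ℝ, 0 < Δ ∧ ∀ (n m : ℕ) (F : SchwartzMap (Fin n → EuclideanSpace ℝ (Fin 4)) ℂ) (G' : SchwartzMap (Fin m → EuclideanSpace ℝ (Fin 4)) ℂ), IsTimeOrdered F → IsTimeOrdered G' → ∃ C : ℝ, ∀ v : EuclideanSpace ℝ (Fin 4), 0 ≤ v 0 → ∀ᶠ k in Filter.atTop, ∀ H : SchwartzMap (Fin (n + m) → EuclideanSpace ℝ (Fin 4)) ℂ, IsAppendTensorOf H (osAdjoint F) (translateMulti v G') → ‖LS k (n + m) H - LS k n (osAdjoint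 F) * LS k m G'‖ ≤ C * Real.exp (-Δ * ‖v‖)) → Filter.Tendsto sch.β Filter.atTop Filter.atTop → (∀ (f g : SchwartzMap (EuclideanSpace ℝ (Fin 4)) ℂ) (F₂ : SchwartzMap (Fin 2 → EuclideanSpace ℝ (Fin 4)) ℂ), IsTensorOf F₂ ![f, g] → IsOffDiagonal F₂ → HasCompactSupport ⇑f → HasCompactSupport ⇑g → ∀ ε : ℝ, 0 < ε → ∃ R : ℝ, ∀ᶠ k in Filter.atTop, ∀ (h : SchwartzMap (EuclideanSpace ℝ (Fin 4)) ℂ) (H : SchwartzMap (Fin 3 → EuclideanSpace ℝ (Fin 4)) ℂ), IsTensorOf H ![f, g, h] → (∀ x, ‖x‖ ≤ R → h x = 0) → (∀ x, ‖h x‖ ≤ 1) → ‖LS k 3 H‖ ≤ ε) → ∃ d : ℝ → ℕ → ℂ, ∀ (f g : SchwartzMap (EuclideanSpace ℝ (Fin 4)) ℂ) (F₂ : SchwartzMap (Fin 2 → EuclideanSpace ℝ (Fin 4)) ℂ), IsTensorOf F₂ ![f, g] → IsOffDiagonal F₂ → HasCompactSupport ⇑f → HasCompactSupport ⇑g → ∀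 ε : ℝ, 0 < ε → ∃ ρ₀ : ℝ, 0 < ρ₀ ∧ ∀ ρ : ℝ, 0 < ρ → ρ < ρ₀ → ∃ (N : ℕ) (H' : Fin N → SchwartzMap (Fin 3 → EuclideanSpace ℝ (Fin 4)) ℂ), (∀ j, ∃ (f' g' h' : SchwartzMap (EuclideanSpace ℝ (Fin 4)) ℂ), IsTensorOf (H' j) ![f', g', h'] ∧ IsOffDiagonal (H' j)) ∧ ∀ᶠ k in Filter.atTop, ‖D k F₂ - ∑ j, LS k 3 (H' j) - d ρ k * LS k 2 F₂‖ ≤ ε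

/-- **Piece B · `CouplingDerivativeTransmutation`** — dimensional transmutation at the two-point level (OPEN). For every
compact simple `G`, `r`, `sch` with (VS), (UVB), (ND), (CL) and `β_k → ∞`: there are compactly supported `f₁,g₁,f₂,g₂` with
`F₁ = f₁⊗g₁`, `F₂ = f₂⊗g₂` off-diagonal and `δ > 0` such that for EVERY `d : ℕ → ℂ`, frequently in `k`,
`δ ≤ ‖D_k F₁ − d_k LS(k,2,F₁)‖ + ‖D_k F₂ − d_k LS(k,2,F₂)‖`. No three-point function occurs. -/
def CouplingDerivativeTransmutation : Prop :=
  open Literature.MathematicalPhysics.QuantumFieldTheory Literature.MathematicalPhysics.QuantumLattice Literature.MathematicalPhysics.AQFT Literature.Probability.LatticeModels in ∀ (G : Type) [Group G] [TopologicalSpace G] [IsTopologicalGroup G] [CompactSpace G], IsCompactSimpleLieGroup G → letI : MeasurableSpace G := borel G; haveI : BorelSpace G := ⟨rfl⟩; ∀ (r : LatticeRep G) (sch : SpeciesScheme (YMSpecies G)), let μ := fun k : ℕ => wilsonMeasure (d := 4) (L := sch.side k) r.ρ (sch.β k); let LS := fun (k n : ℕ) (F : SchwartzMap (Fin n → EuclideanSpace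 ℝ (Fin 4)) ℂ) => (∫ U, ∑ x : Fin n → ↥(box 4 (sch.L k)), F (fun i => sch.a k • siteToE ↑(x i)) * ∏ i, ((sch.c r.curvature k * sch.a k ^ 4 * (r.curvature.F (configShift (-↑(x i)) (torusLift (sch.side k) U)) - sch.m r.curvature k) : ℝ) : ℂ) ∂μ k); let LSb := fun (k n : ℕ) (F : SchwartzMap (Fin n → EuclideanSpace ℝ (Fin 4)) ℂ) (b : ℝ) => (∫ U, ∑ x : Fin n → ↥(box 4 (sch.L k)), F (fun i => sch.a k • siteToE ↑(x i)) * ∏ i, ((sch.c r.curvature k * sch.a k ^ 4 * (r.curvature.F (configShift (-↑(x i)) (torusLift (sch.side k) U)) - sch.m r.curvature k) : ℝ) : ℂ) ∂(wilsonMeasure (d := 4) (L := sch.side k) r.ρ b)); let D := fun (k : ℕ) (F : SchwartzMap (Fin 2 → EuclideanSpace ℝ (Fin 4)) ℂ) => ((sch.c r.curvature k * sch.a k ^ 4 : ℝ) : ℂ) * deriv (fun b : ℝ => LSb k 2 F b) (sch.β k); (∀ k : ℕ, sch.m r.curvature k = ∫ U, r.curvature.F (torusLift (sch.side k) U) ∂μ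 k) → (∃ (s : ℕ) (α β : ℝ), ∀ (n : ℕ) (F : SchwartzMap (Fin n → EuclideanSpace ℝ (Fin 4)) ℂ), IsOffDiagonal F → ∀ᶠ k in Filter.atTop, ‖LS k n F‖ ≤ α * (n.factorial : ℝ) ^ β * schwartzNorm (n * s) F) → (∃ (f g : SchwartzMap (Fin 1 → EuclideanSpace ℝ (Fin 4)) ℂ) (H : SchwartzMap (Fin (1 + 1) → EuclideanSpace ℝ (Fin 4)) ℂ), IsTimeOrdered f ∧ IsTimeOrdered g ∧ IsAppendTensorOf H (osAdjoint f) g ∧ ∃ δ : ℝ, 0 < δ ∧ ∀ᶠ k in Filter.atTop, δ ≤ ‖LS k (1 + 1) H‖) → (∃ Δ : ℝ, 0 < Δ ∧ ∀ (n m : ℕ) (F : SchwartzMap (Fin n → EuclideanSpace ℝ (Fin 4)) ℂ) (G' : SchwartzMap (Fin m → EuclideanSpace ℝ (Fin 4)) ℂ), IsTimeOrdered F → IsTimeOrdered G' → ∃ C : ℝ, ∀ v : EuclideanSpace ℝ (Fin 4), 0 ≤ v 0 → ∀ᶠ k in Filter.atTop, ∀ H : SchwartzMap (Fin (n + m) →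 EuclideanSpace ℝ (Fin 4)) ℂ, IsAppendTensorOf H (osAdjoint F) (translateMulti v G') → ‖LS k (n + m) H - LS k n (osAdjoint F) * LS k m G'‖ ≤ C * Real.exp (-Δ * ‖v‖)) → Filter.Tendsto sch.β Filter.atTop Filter.atTop → ∃ (f₁ g₁ f₂ g₂ : SchwartzMap (EuclideanSpace ℝ (Fin 4)) ℂ) (F₁ F₂ : SchwartzMap (Fin 2 → EuclideanSpace ℝ (Fin 4)) ℂ), IsTensorOf F₁ ![f₁, g₁] ∧ IsTensorOf F₂ ![f₂, g₂] ∧ IsOffDiagonal F₁ ∧ IsOffDiagonal F₂ ∧ HasCompactSupport ⇑f₁ ∧ HasCompactSupport ⇑g₁ ∧ HasCompactSupport ⇑f₂ ∧ HasCompactSupport ⇑g₂ ∧ ∃ δ : ℝ, 0 < δ ∧ ∀ d : ℕ → ℂ, ∃ᶠ k in Filter.atTop, δ ≤ ‖D k F₁ - d k * LS k 2 F₁‖ + ‖D k F₂ - d k * LS k 2 F₂‖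

/-- **Piece C · `NonGaussianityOffScaling`** — the crux OUTSIDE the (asymptotically free ∧ uniformly clustering) regime
(OPEN; scope piece of the universal quantifier: non-AF "continuum limits" at strong / intermediate / critical finite bare
coupling or negative coupling, and AF schemes without uniform clustering — believed void given the mass gap). -/
def NonGaussianityOffScaling : Prop :=
  open Literature.MathematicalPhysics.QuantumFieldTheory Literature.MathematicalPhysics.QuantumLattice Literature.MathematicalPhysics.AQFT Literature.Probability.LatticeModels in ∀ (G : Type) [Group G] [TopologicalSpace G] [IsTopologicalGroup G] [CompactSpace G], IsCompactSimpleLieGroup G → letI : MeasurableSpace G := borel G; haveI : BorelSpace G := ⟨rfl⟩; ∀ (r : LatticeRep G) (sch : SpeciesScheme (YMSpecies G)), let μ := fun k : ℕ => wilsonMeasure (d := 4) (L := sch.side k) r.ρ (sch.β k); let LS := fun (k n : ℕ) (F : SchwartzMap (Fin n → EuclideanSpace ℝ (Fin 4)) ℂ) => (∫ U, ∑ x : Fin n → ↥(box 4 (sch.L k)), F (fun i => sch.a k • siteToE ↑(x i)) * ∏ i, ((sch.c r.curvature k * sch.a k ^ 4 * (r.curvature.F (configShift (-↑(x i)) (torusLift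 (sch.side k) U)) - sch.m r.curvature k) : ℝ) : ℂ) ∂μ k); (∀ k : ℕ, sch.m r.curvature k = ∫ U, r.curvature.F (torusLift (sch.side k) U) ∂μ k) → (∃ (s : ℕ) (α β : ℝ), ∀ (n : ℕ) (F : SchwartzMap (Fin n → EuclideanSpace ℝ (Fin 4)) ℂ), IsOffDiagonal F → ∀ᶠ k in Filter.atTop, ‖LS k n F‖ ≤ α * (n.factorial : ℝ) ^ β * schwartzNorm (n * s) F) → (∃ (f g : SchwartzMap (Fin 1 → EuclideanSpace ℝ (Fin 4)) ℂ) (H : SchwartzMap (Fin (1 + 1) → EuclideanSpace ℝ (Fin 4)) ℂ), IsTimeOrdered f ∧ IsTimeOrdered g ∧ IsAppendTensorOf H (osAdjoint f) g ∧ ∃ δ : ℝ, 0 < δ ∧ ∀ᶠ k in Filter.atTop, δ ≤ ‖LS k (1 + 1) H‖) → (∃ Δ : ℝ, 0 < Δ ∧ ∀ (n m : ℕ) (F : SchwartzMap (Fin n → EuclideanSpace ℝ (Fin 4)) ℂ) (G' : SchwartzMap (Fin m → EuclideanSpace ℝ (Fin 4)) ℂ), IsTimeOrdered F → IsTimeOrdered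 G' → ∃ C : ℝ, ∀ v : EuclideanSpace ℝ (Fin 4), 0 ≤ v 0 → ∀ᶠ k in Filter.atTop, ∀ H : SchwartzMap (Fin (n + m) → EuclideanSpace ℝ (Fin 4)) ℂ, IsAppendTensorOf H (osAdjoint F) (translateMulti v G') → ‖LS k (n + m) H - LS k n (osAdjoint F) * LS k m G'‖ ≤ C * Real.exp (-Δ * ‖v‖)) → ¬ (Filter.Tendsto sch.β Filter.atTop Filter.atTop ∧ (∀ (f g : SchwartzMap (EuclideanSpace ℝ (Fin 4)) ℂ) (F₂ : SchwartzMap (Fin 2 → EuclideanSpace ℝ (Fin 4)) ℂ), IsTensorOf F₂ ![f, g] → IsOffDiagonal F₂ → HasCompactSupport ⇑f → HasCompactSupport ⇑g → ∀ ε : ℝ, 0 < ε → ∃ R : ℝ, ∀ᶠ k in Filter.atTop, ∀ (h : SchwartzMap (EuclideanSpace ℝ (Fin 4)) ℂ) (H : SchwartzMap (Fin 3 → EuclideanSpace ℝ (Fin 4)) ℂ), IsTensorOf H ![f, g, h] → (∀ x, ‖x‖ ≤ R → h x = 0) → (∀ x, ‖h x‖ ≤ 1) → ‖LS k 3 H‖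 ≤ ε)) → ∃ (f g h : SchwartzMap (EuclideanSpace ℝ (Fin 4)) ℂ) (F₃ : SchwartzMap (Fin 3 → EuclideanSpace ℝ (Fin 4)) ℂ), IsTensorOf F₃ ![f, g, h] ∧ IsOffDiagonal F₃ ∧ ∃ δ : ℝ, 0 < δ ∧ ∃ᶠ k in Filter.atTop, δ ≤ ‖LS k 3 F₃‖

/-! ## §3 The assembly -/

/-- **Assembly of the split**: `AnomalyInsertionLocality → CouplingDerivativeTransmutation → NonGaussianityOffScaling →
CurvatureNonGaussianity` (the ROUTE decl, by name). Fix `G, r, sch`, the let-bound `μ, LS` and the four hypotheses; by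
`Classical.em` on `(β_k → ∞) ∧ UC` (the proposition is read off piece C's hypothesis by unification); good regime:
`anomaly_dichotomy` fed with A and B (the let-bound functionals unify by ζ/β); bad regime: piece C. [folklore] -/
theorem curvatureNonGaussianity_of_subs (hA : AnomalyInsertionLocality) (hB : CouplingDerivativeTransmutation)
    (hC : NonGaussianityOffScaling) :
    Summit.QuantumFields.YangMills.Theses.FlowLineStateSpace.CurvatureNonGaussianity := by
  intro G _ _ _ _ hG r sch μ LS hVS hUVB hND hCL
  refine (Classical.em _).elim (fun hgood => ?_) (fun hbad => hC G hG r sch hVS hUVB hND hCL hbad)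
  exact anomaly_dichotomy (hA G hG r sch hVS hUVB hND hCL hgood.1 hgood.2)
    (hB G hG r sch hVS hUVB hND hCL hgood.1)

end Summit.QuantumFields.YangMills.Theorems.CurvatureNonGaussianitySplit
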